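import Literature.AlgebraicGeometry.GroupSchemes.KernelIdealSpecialFibre
import Literature.AlgebraicGeometry.GroupSchemes.HopfIdealOfClosedSubgroup
import Literature.AlgebraicGeometry.GroupSchemes.BarsottiTateGroupBaseChange
import Literature.RingTheory.Flat.HopfIdealClosureGenericFibre
import HarnessLib

/-!
# THE CLOSURE SUBSCHEME `V(J^sat) ↪ 𝒢` OF A HOPF IDEAL OF THE GENERIC FIBRE AND ITS TWO FIBRES
# ([EGAIV2] Prop. 2.8.5; [Tate1997FiniteFlatGroupSchemes] (3.7))

Topic `Literature/AlgebraicGeometry/GroupSchemes`; namespace `Literature.AlgebraicGeometry.GroupSchemes.AffineGroupScheme`.  THEOREMS ONLY (no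
definition, no instance, no notation, no named fact, no `sorry`).  Cell `hodgecm-mathlib` (D-0151), programme P6 «MOD» (crux hLiu418 =
stmt-HodgeConjecture-24832, `--supports`, count-neutral): the SCHEME-SIDE reading of ★ S1 `AdmissibleIdealSpecialFibre.spI` — the glue between the
Hopf-IDEAL currency of the L2 leaflet (`spGeoOf := spI …` of the line's admissible ideal, transported to the dock) and the SUB-OBJECT currency
`incl : 𝒦 → 𝒜_x̃`, `[Flat 𝒦.hom]` of ★ (ν8R-model) `AbelianSchemeHomReductionSpecialFibreModel.exists_specialFibre_hom_reduction_model` (v-b) «a flat subgroup of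
the valuation-ring model killed upstairs is killed downstairs» — organ (ρ1) «reduced roof hom» of the `RedHomLaw` road of `stub_SPGEOM` (LA2-plan (g0) deal
2026-09-02T05:21:50Z to LA1-p02 (g2)).  HC_CM is proved only modulo the printed citations (2 remaining named inputs hLiu418 24832, h413 24833) until rung 0
closes; this file is generic and changes no count.

THE MATHEMATICS.  `R` a Bézout domain (e.g. a valuation ring) with fraction field `K`, `κ` an `R`-field, `𝒢` an affine `R`-group scheme with
`A = Γ(𝒢)`, `e_S : Γ(𝒢_S) ≅ S ⊗_R A` (★ `algBaseChangeEquiv`), and `J ⊂ Γ(𝒢_K)` a Hopf ideal.  Its SATURATION `J^sat := e_K(J) ∩ A ⊂ A` (along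
`includeRight : A → K ⊗_R A`, a localisation) is a Hopf ideal with `A ⧸ J^sat` FLAT over `R` (★ `HopfIdealClosureGenericFibre`: torsion-free over Bézout), so
`𝒦 := V(J^sat) = Spec (A ⧸ J^sat) ↪ 𝒢` (★ `quotIncl`) is a flat closed subgroup scheme — the schematic closure of `V(J) ↪ 𝒢_K` ([EGAIV2] 2.8.5).  The ideal
of the base change `𝒦_S ↪ 𝒢_S` is `e_S⁻¹(J^sat·(S ⊗_R A))` (★ `CanonicalLine.comap_algBaseChangeEquiv_map_includeRight_ker_eq`, right exactness of `S ⊗_R −`);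
for `S = K` this is `e_K⁻¹(e_K J) = J` (every ideal of the localisation `K ⊗_R A` is extended, ★ `map_comap_includeRight`), and for `S = κ` it is
`spI K κ 𝒢 J` ON THE NOSE (★ `spI_eq`).  Hence, by the points criteria for closed subschemes of affine schemes (★ `exists_comp_quotIncl_eq_of_affine`,
★ `exists_comp_eq_of_le_ker`): `𝒦_K` factors through `V(J) ↪ 𝒢_K` and `V(spI J) ↪ 𝒢_κ` factors through `𝒦_κ`; so a morphism `g : 𝒢_K → M` to a monoid
object killing `V(J)` kills `𝒦_K`, and a morphism `g : 𝒢_κ → M` killing `𝒦_κ` kills `V(spI J)` — the two conversions around ★ (ν8R-model) (v-b).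

* §1 `isHopfIdeal_map_algBaseChangeEquiv`, `isHopfIdeal_sat`, `moduleFlat_quotient_sat`, **`flat_specOver_quotient_sat_hom`** (`[Flat 𝒦.hom]`);
* §2 `ker_comap_pullback_map_quotIncl_sat` (any `S`), **`ker_comap_pullback_map_quotIncl_sat_eq`** (`S = K`: `= J`),
  **`ker_comap_pullback_map_quotIncl_sat_eq_spI`** (`S = κ`: `= spI K κ 𝒢 J`);
* §3 **`exists_comp_quotIncl_eq_pullback_map_quotIncl_sat`** (`𝒦_K → V(J)` over `𝒢_K`), **`exists_comp_pullback_map_quotIncl_sat_eq_quotIncl_spI`**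
  (`V(spI J) → 𝒦_κ` over `𝒢_κ`);
* §4 HEADS **`pullback_map_quotIncl_sat_comp_eq_one`** (kills `V(J)` ⇒ kills `𝒦_K`), **`quotIncl_spI_comp_eq_one_of_pullback_map`** (kills `𝒦_κ` ⇒ kills
  `V(spI J)`).

## References
* [EGAIV2] A. Grothendieck, J. Dieudonné, *ÉGA* IV₂, Publ. Math. IHÉS 24 (1965), Prop. 2.8.5.
* [Tate1997FiniteFlatGroupSchemes] J. Tate, *Finite flat group schemes* (1997), (3.7).
* [GortzWedhorn2023] U. Görtz, T. Wedhorn, *Algebraic Geometry II* (2023), (27.1.1), §(27.2) (27.2.1) (pp. 606–607).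
* [GortzWedhorn2020] U. Görtz, T. Wedhorn, *Algebraic Geometry I*, 2nd ed. (2020), Section (4.7) (pp. 107–108), Prop. 14.14.
* [Waterhouse1979] W. C. Waterhouse, *Introduction to Affine Group Schemes*, GTM 66 (1979), §2.1 (p. 14).
-/

set_option autoImplicit false

set_option backward.isDefEq.respectTransparency false

universe u

open CategoryTheory CategoryTheory.Limits AlgebraicGeometry MonoidalCategory CartesianMonoidalCategory TensorProduct
open Algebra.TensorProduct (includeRight)

noncomputable section

namespace Literature.AlgebraicGeometry.GroupSchemes

namespace AffineGroupScheme

open scoped MonObj CategoryTheory.Obj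

open Literature.AlgebraicGeometry.Motives

variable {R : Type u} [CommRing R] (K κ : Type u) [Field K] [Algebra R K] [Field κ] [Algebra R κ]
  (G : SchemeOver R) [GrpObj G] [IsAffine G.left]
  [IsAffine ((Over.pullback (Spec.map (CommRingCat.ofHom (algebraMap R K)))).obj G).left]
  [IsAffine ((Over.pullback (Spec.map (CommRingCat.ofHom (algebraMap R κ)))).obj G).left]
  (J : Ideal (Alg ((Over.pullback (Spec.map (CommRingCat.ofHom (algebraMap R K)))).obj G)))

/-! ## §1 The saturation `J^sat = e_K(J) ∩ Γ(𝒢)` is a Hopf ideal with flat quotient; `V(J^sat) → Spec R` is flat -/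

omit [IsAffine ((Over.pullback (Spec.map (CommRingCat.ofHom (algebraMap R κ)))).obj G).left] in
/-- `e_K(J) ⊂ K ⊗_R Γ(𝒢)` is a Hopf ideal when `J` is (★ S1 along the bialgebra isomorphism `e_K`). [cite: GortzWedhorn2023, §(27.2) (27.2.1) (pp. 606–607)] -/
theorem isHopfIdeal_map_algBaseChangeEquiv (hJ : J.IsHopfIdeal K) : (J.map (algBaseChangeEquiv K G)).IsHopfIdeal K :=
  (isHopfIdeal_and_finrank_and_map_le_map_algBaseChangeEquiv K G (fun a : PEmpty.{1} => a.elim) _ J ⟨hJ, rfl, fun a => a.elim⟩).1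

omit [IsAffine ((Over.pullback (Spec.map (CommRingCat.ofHom (algebraMap R κ)))).obj G).left] in
/-- **`J^sat` IS A HOPF IDEAL of `Γ(𝒢)`** over a Bézout domain `R` with fraction field `K` (★ `isHopfIdeal_comap_includeRight_of_isBezout`: the closure of a
closed subgroup of the generic fibre is a subgroup). [cite: EGAIV2, Prop. 2.8.5] [cite: Tate1997FiniteFlatGroupSchemes, (3.7)] -/
theorem isHopfIdeal_sat [IsFractionRing R K] [IsBezout R] [IsDomain R] (hJ : J.IsHopfIdeal K) :
    ((J.map (algBaseChangeEquiv K G)).comap (includeRight : Alg G →ₐ[R] K ⊗[R] Alg G)).IsHopfIdeal R := by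
  haveI := isHopfIdeal_map_algBaseChangeEquiv K G J hJ
  exact Literature.RingTheory.Flat.isHopfIdeal_comap_includeRight_of_isBezout (J.map (algBaseChangeEquiv K G))

omit [IsAffine ((Over.pullback (Spec.map (CommRingCat.ofHom (algebraMap R κ)))).obj G).left] in
/-- **`Γ(𝒢) ⧸ J^sat` IS FLAT** over the Bézout domain `R` (torsion-free: it embeds in the `K`-algebra `Γ(𝒢_K) ⧸ J`). [cite: EGAIV2, Prop. 2.8.5]
[cite: GortzWedhorn2020, Prop. 14.14] -/
theorem moduleFlat_quotient_sat [IsFractionRing R K] [IsBezout R] [IsDomain R] :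
    Module.Flat R (Alg G ⧸ (J.map (algBaseChangeEquiv K G)).comap (includeRight : Alg G →ₐ[R] K ⊗[R] Alg G)) :=
  Literature.RingTheory.Flat.flat_quotient_comap_includeRight_of_isBezout (J.map (algBaseChangeEquiv K G))

omit [IsAffine ((Over.pullback (Spec.map (CommRingCat.ofHom (algebraMap R κ)))).obj G).left] in
/-- **`𝒦 = V(J^sat) = Spec (Γ(𝒢) ⧸ J^sat) → Spec R` IS FLAT** — the `[Flat 𝒦.hom]` input of ★ (ν8R-model) (v-b). [cite: EGAIV2, Prop. 2.8.5]
[cite: GortzWedhorn2020, Prop. 14.14] -/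
theorem flat_specOver_quotient_sat_hom [IsFractionRing R K] [IsBezout R] [IsDomain R] :
    Flat (Motives.specOver R (Alg G ⧸ (J.map (algBaseChangeEquiv K G)).comap (includeRight : Alg G →ₐ[R] K ⊗[R] Alg G))).hom := by
  haveI := moduleFlat_quotient_sat K G J
  change Flat (Spec.map (CommRingCat.ofHom (algebraMap R (Alg G ⧸ (J.map (algBaseChangeEquiv K G)).comap (includeRight : Alg G →ₐ[R] K ⊗[R] Alg G)))))
  rw [HasRingHomProperty.Spec_iff (P := @Flat), CommRingCat.hom_ofHom, RingHom.flat_algebraMap_iff]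
  infer_instance

/-! ## §2 The ideal of the base change `𝒦_S ↪ 𝒢_S`: `e_S⁻¹(J^sat·(S ⊗_R Γ(𝒢)))`; `= J` for `S = K`, `= spI J` for `S = κ` -/

omit [IsAffine ((Over.pullback (Spec.map (CommRingCat.ofHom (algebraMap R κ)))).obj G).left] in
/-- **THE IDEAL OF `𝒦_S ↪ 𝒢_S` IS THE EXTENSION OF `J^sat`** read through `e_S` (★ `CanonicalLine.comap_algBaseChangeEquiv_map_includeRight_ker_eq` at the closed
subgroup `quotIncl 𝒢 J^sat`, a group scheme by ★ `exists_grpObj_isMonHom_quotIncl`; ★ `ker_appTop_quotIncl`). [cite: EGAIV2, Prop. 2.8.5]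
[cite: GortzWedhorn2020, Section (4.7) (pp. 107–108)] -/
theorem ker_comap_pullback_map_quotIncl_sat (S : Type u) [CommRing S] [Algebra R S]
    [IsAffine ((Over.pullback (Spec.map (CommRingCat.ofHom (algebraMap R S)))).obj G).left]
    [IsFractionRing R K] [IsBezout R] [IsDomain R] (hJ : J.IsHopfIdeal K) :
    (RingHom.ker (Alg.comap ((Over.pullback (Spec.map (CommRingCat.ofHom (algebraMap R S)))).map
        (quotIncl G ((J.map (algBaseChangeEquiv K G)).comap (includeRight : Alg G →ₐ[R] K ⊗[R] Alg G))))).toRingHom :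
        Ideal (Alg ((Over.pullback (Spec.map (CommRingCat.ofHom (algebraMap R S)))).obj G))) =
      ((((J.map (algBaseChangeEquiv K G)).comap (includeRight : Alg G →ₐ[R] K ⊗[R] Alg G)).map
          (includeRight : Alg G →ₐ[R] S ⊗[R] Alg G)).comap (algBaseChangeEquiv S G)) := by
  haveI := isHopfIdeal_sat K G J hJ
  obtain ⟨GZ, _⟩ := exists_grpObj_isMonHom_quotIncl G ((J.map (algBaseChangeEquiv K G)).comap (includeRight : Alg G →ₐ[R] K ⊗[R] Alg G))
  letI := GZ
  haveI : IsAffine (Motives.specOver R (Alg G ⧸ (J.map (algBaseChangeEquiv K G)).comap (includeRight : Alg G →ₐ[R] K ⊗[R] Alg G))).left :=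
    inferInstanceAs (IsAffine (Spec _))
  haveI : IsClosedImmersion (quotIncl G ((J.map (algBaseChangeEquiv K G)).comap (includeRight : Alg G →ₐ[R] K ⊗[R] Alg G))).left :=
    isClosedImmersion_quotIncl_left G _
  haveI : IsAffine ((Over.pullback (Spec.map (CommRingCat.ofHom (algebraMap R S)))).obj
      (Motives.specOver R (Alg G ⧸ (J.map (algBaseChangeEquiv K G)).comap (includeRight : Alg G →ₐ[R] K ⊗[R] Alg G)))).left :=
    inferInstanceAs (IsAffine (pullback _ _))
  have hker : (RingHom.ker (Alg.comap (quotIncl G ((J.map (algBaseChangeEquiv K G)).comap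
      (includeRight : Alg G →ₐ[R] K ⊗[R] Alg G)))).toRingHom : Ideal (Alg G)) =
        (J.map (algBaseChangeEquiv K G)).comap (includeRight : Alg G →ₐ[R] K ⊗[R] Alg G) :=
    ker_appTop_quotIncl G _
  rw [← CanonicalLine.comap_algBaseChangeEquiv_map_includeRight_ker_eq S G (Motives.specOver R _)
    (quotIncl G ((J.map (algBaseChangeEquiv K G)).comap (includeRight : Alg G →ₐ[R] K ⊗[R] Alg G))), hker]

omit [IsAffine ((Over.pullback (Spec.map (CommRingCat.ofHom (algebraMap R κ)))).obj G).left] in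
/-- **GENERIC FIBRE: the ideal of `𝒦_K ↪ 𝒢_K` is `J`** (`e_K⁻¹(e_K J) = J`: ideals of the localisation `K ⊗_R Γ(𝒢)` are extended, ★ `map_comap_includeRight`).
[cite: EGAIV2, Prop. 2.8.5] [cite: GortzWedhorn2020, Prop. 14.14] -/
theorem ker_comap_pullback_map_quotIncl_sat_eq [IsFractionRing R K] [IsBezout R] [IsDomain R] (hJ : J.IsHopfIdeal K) :
    (RingHom.ker (Alg.comap ((Over.pullback (Spec.map (CommRingCat.ofHom (algebraMap R K)))).map
        (quotIncl G ((J.map (algBaseChangeEquiv K G)).comap (includeRight : Alg G →ₐ[R] K ⊗[R] Alg G))))).toRingHom :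
        Ideal (Alg ((Over.pullback (Spec.map (CommRingCat.ofHom (algebraMap R K)))).obj G))) = J := by
  rw [ker_comap_pullback_map_quotIncl_sat K G J K hJ, Literature.RingTheory.Flat.map_comap_includeRight]
  exact Ideal.comap_map_of_bijective _ (algBaseChangeEquiv K G).bijective

/-- **SPECIAL FIBRE: the ideal of `𝒦_κ ↪ 𝒢_κ` is `spI K κ 𝒢 J`** ON THE NOSE (★ `spI_eq`). [cite: EGAIV2, Prop. 2.8.5] [cite: Tate1997FiniteFlatGroupSchemes, (3.7)] -/
theorem ker_comap_pullback_map_quotIncl_sat_eq_spI [IsFractionRing R K] [IsBezout R] [IsDomain R] (hJ : J.IsHopfIdeal K) :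
    (RingHom.ker (Alg.comap ((Over.pullback (Spec.map (CommRingCat.ofHom (algebraMap R κ)))).map
        (quotIncl G ((J.map (algBaseChangeEquiv K G)).comap (includeRight : Alg G →ₐ[R] K ⊗[R] Alg G))))).toRingHom :
        Ideal (Alg ((Over.pullback (Spec.map (CommRingCat.ofHom (algebraMap R κ)))).obj G))) = spI K κ G J := by
  rw [ker_comap_pullback_map_quotIncl_sat K G J κ hJ, spI_eq]

/-! ## §3 The two factorisations: `𝒦_K → V(J)` over `𝒢_K` and `V(spI J) → 𝒦_κ` over `𝒢_κ` -/

omit [IsAffine ((Over.pullback (Spec.map (CommRingCat.ofHom (algebraMap R κ)))).obj G).left] in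
/-- **`𝒦_K` FACTORS THROUGH `V(J) ↪ 𝒢_K`** (points criterion ★ `exists_comp_quotIncl_eq_of_affine`: the ideal of `𝒦_K ↪ 𝒢_K` is `J`).
[cite: GortzWedhorn2023, (27.1.1) and §(27.2) (p. 607)] [cite: EGAIV2, Prop. 2.8.5] -/
theorem exists_comp_quotIncl_eq_pullback_map_quotIncl_sat [IsFractionRing R K] [IsBezout R] [IsDomain R] (hJ : J.IsHopfIdeal K) :
    ∃ m : (Over.pullback (Spec.map (CommRingCat.ofHom (algebraMap R K)))).obj
          (Motives.specOver R (Alg G ⧸ (J.map (algBaseChangeEquiv K G)).comap (includeRight : Alg G →ₐ[R] K ⊗[R] Alg G))) ⟶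
        Motives.specOver K (Alg ((Over.pullback (Spec.map (CommRingCat.ofHom (algebraMap R K)))).obj G) ⧸ J),
      m ≫ quotIncl _ J = (Over.pullback (Spec.map (CommRingCat.ofHom (algebraMap R K)))).map
        (quotIncl G ((J.map (algBaseChangeEquiv K G)).comap (includeRight : Alg G →ₐ[R] K ⊗[R] Alg G))) := by
  haveI : IsAffine (Motives.specOver R (Alg G ⧸ (J.map (algBaseChangeEquiv K G)).comap (includeRight : Alg G →ₐ[R] K ⊗[R] Alg G))).left :=
    inferInstanceAs (IsAffine (Spec _))
  haveI : IsAffine ((Over.pullback (Spec.map (CommRingCat.ofHom (algebraMap R K)))).obj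
      (Motives.specOver R (Alg G ⧸ (J.map (algBaseChangeEquiv K G)).comap (includeRight : Alg G →ₐ[R] K ⊗[R] Alg G)))).left :=
    inferInstanceAs (IsAffine (pullback _ _))
  refine exists_comp_quotIncl_eq_of_affine _ J _ ?_
  rw [ker_ptEquiv_isoSpecOver_inv_comp_eq]
  exact le_of_eq (ker_comap_pullback_map_quotIncl_sat_eq K G J hJ).symm

/-- **`V(spI J) ↪ 𝒢_κ` FACTORS THROUGH `𝒦_κ`** (points criterion ★ `exists_comp_eq_of_le_ker` for the closed immersion `𝒦_κ ↪ 𝒢_κ`, whose ideal is `spI J`).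
[cite: GortzWedhorn2023, (27.1.1) and §(27.2) (p. 607)] [cite: EGAIV2, Prop. 2.8.5] [cite: Tate1997FiniteFlatGroupSchemes, (3.7)] -/
theorem exists_comp_pullback_map_quotIncl_sat_eq_quotIncl_spI [IsFractionRing R K] [IsBezout R] [IsDomain R] (hJ : J.IsHopfIdeal K) :
    ∃ m : Motives.specOver κ (Alg ((Over.pullback (Spec.map (CommRingCat.ofHom (algebraMap R κ)))).obj G) ⧸ spI K κ G J) ⟶
        (Over.pullback (Spec.map (CommRingCat.ofHom (algebraMap R κ)))).obj
          (Motives.specOver R (Alg G ⧸ (J.map (algBaseChangeEquiv K G)).comap (includeRight : Alg G →ₐ[R] K ⊗[R] Alg G))),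
      m ≫ (Over.pullback (Spec.map (CommRingCat.ofHom (algebraMap R κ)))).map
          (quotIncl G ((J.map (algBaseChangeEquiv K G)).comap (includeRight : Alg G →ₐ[R] K ⊗[R] Alg G))) =
        quotIncl _ (spI K κ G J) := by
  haveI : IsAffine (Motives.specOver R (Alg G ⧸ (J.map (algBaseChangeEquiv K G)).comap (includeRight : Alg G →ₐ[R] K ⊗[R] Alg G))).left :=
    inferInstanceAs (IsAffine (Spec _))
  haveI : IsAffine ((Over.pullback (Spec.map (CommRingCat.ofHom (algebraMap R κ)))).obj
      (Motives.specOver R (Alg G ⧸ (J.map (algBaseChangeEquiv K G)).comap (includeRight : Alg G →ₐ[R] K ⊗[R] Alg G)))).left :=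
    inferInstanceAs (IsAffine (pullback _ _))
  haveI : IsClosedImmersion (quotIncl G ((J.map (algBaseChangeEquiv K G)).comap (includeRight : Alg G →ₐ[R] K ⊗[R] Alg G))).left :=
    isClosedImmersion_quotIncl_left G _
  haveI : IsClosedImmersion ((Over.pullback (Spec.map (CommRingCat.ofHom (algebraMap R κ)))).map
      (quotIncl G ((J.map (algBaseChangeEquiv K G)).comap (includeRight : Alg G →ₐ[R] K ⊗[R] Alg G)))).left :=
    of_pullback_map_left _ (P := @IsClosedImmersion) _ inferInstance
  refine exists_comp_eq_of_le_ker _ _ ?_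
  rw [ker_ptEquiv_isoSpecOver_inv_comp_eq, ptEquiv_quotIncl]
  intro a ha
  have ha' : a ∈ spI K κ G J := by
    rw [← ker_comap_pullback_map_quotIncl_sat_eq_spI K κ G J hJ]; exact ha
  rw [RingHom.mem_ker, AlgHom.toRingHom_eq_coe, AlgHom.coe_toRingHom, Ideal.Quotient.mkₐ_eq_mk, Ideal.Quotient.eq_zero_iff_mem]
  exact ha'

/-! ## §4 HEADS: kills-statements convert between `V(J)`, `𝒦` and `V(spI J)` -/

omit [IsAffine ((Over.pullback (Spec.map (CommRingCat.ofHom (algebraMap R κ)))).obj G).left] in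
/-- **A MORPHISM KILLING `V(J) ↪ 𝒢_K` KILLS `𝒦_K`** (`M` any monoid object over `K`; §3 and Mathlib `MonObj.comp_one`) — the conversion INTO the generic kill
hypothesis of ★ (ν8R-model) (v-b). [cite: EGAIV2, Prop. 2.8.5] [cite: Waterhouse1979, §2.1 (p. 14)] -/
theorem pullback_map_quotIncl_sat_comp_eq_one [IsFractionRing R K] [IsBezout R] [IsDomain R] (hJ : J.IsHopfIdeal K)
    {M : SchemeOver K} [MonObj M] (g : (Over.pullback (Spec.map (CommRingCat.ofHom (algebraMap R K)))).obj G ⟶ M)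
    (hg : quotIncl _ J ≫ g = 1) :
    (Over.pullback (Spec.map (CommRingCat.ofHom (algebraMap R K)))).map
        (quotIncl G ((J.map (algBaseChangeEquiv K G)).comap (includeRight : Alg G →ₐ[R] K ⊗[R] Alg G))) ≫ g = 1 := by
  obtain ⟨m, hm⟩ := exists_comp_quotIncl_eq_pullback_map_quotIncl_sat K G J hJ
  rw [← hm, Category.assoc, hg, MonObj.comp_one]

/-- **A MORPHISM KILLING `𝒦_κ` KILLS `V(spI J) ↪ 𝒢_κ`** (`M` any monoid object over `κ`) — the conversion OUT OF the special kill conclusion of ★ (ν8R-model)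
(v-b), into the currency of ★ (O-K) `quotIncl_spI_comp_eq_one` and of the L2 leaflet's `spGeoOf`. [cite: EGAIV2, Prop. 2.8.5] [cite: Tate1997FiniteFlatGroupSchemes, (3.7)] -/
theorem quotIncl_spI_comp_eq_one_of_pullback_map [IsFractionRing R K] [IsBezout R] [IsDomain R] (hJ : J.IsHopfIdeal K)
    {M : SchemeOver κ} [MonObj M] (g : (Over.pullback (Spec.map (CommRingCat.ofHom (algebraMap R κ)))).obj G ⟶ M)
    (hg : (Over.pullback (Spec.map (CommRingCat.ofHom (algebraMap R κ)))).map
        (quotIncl G ((J.map (algBaseChangeEquiv K G)).comap (includeRight : Alg G →ₐ[R] K ⊗[R] Alg G))) ≫ g = 1) :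
    quotIncl _ (spI K κ G J) ≫ g = 1 := by
  obtain ⟨m, hm⟩ := exists_comp_pullback_map_quotIncl_sat_eq_quotIncl_spI K κ G J hJ
  rw [← hm, Category.assoc, hg, MonObj.comp_one]

end AffineGroupScheme

end Literature.AlgebraicGeometry.GroupSchemes

end
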